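import Literature.Topology.FourManifolds.FeetOnLeftHandDisc
import Literature.AlgebraicTopology.FundamentalGroup.FlowTracks
import Literature.AlgebraicTopology.FundamentalGroup.PathSegment
import HarnessLib

/-!
# The basis loop through a `1`-handle, rewritten for the slide

Topic `Literature/Topology/FourManifolds` (fact seat
`provefact-Literature.Topology.FourManifolds.lauden-f709dd520c`, Laudenbach–Poénaru's Lemma 2: the
free generator `x_q = [α₋ · C_q · α₊⁻¹]` of `π₁` of a `1`-handlebody (`C_q` an arc onto the
left-hand disc of `q`, `α±` in the `0`-handle; `BallWithArcsBasis.lean`,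
`OneHandlebodyArcsExposed.lean`) has to be brought into the shape
`[A₋ · K · A₊⁻¹]` consumed by the slide formula (`SlideDiffeomorphism.lean`): `A±` inside the
sublevel set `{f ≤ c}` of the seed level, ending at the centres `v±` of the flowed-down feet
discs, and `K` running up the flow line of `v₋` to the foot, along the axis of the handle
through `q`, and down the flow line to `v₊` — a path fixed pointwise by the slide
diffeomorphism).  Everything here is **proved**; no named facts.

In the setting of `FeetOnLeftHandDisc.lean` (`h : Compat L C`: a left-sphere setting `L` for
the nice Morse function `g` and a slide context `C` for `f = C.S.f = g + d` near `q`, with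
compatible charts), for an injective arc `C_q` onto `leftHandDisc g ξ q L.b` along which `ξ`
does not decrease `f` (and increases it off the critical points):

* `Compat.exists_feet_params` — the two feet of the handle are `C_q t₋`, `C_q t₊` for
  parameters `t₋ < s_q < t₊` on either side of the critical parameter; on `[t₋, t₊]` the arc
  runs in the handle region along the axis (`f ∈ [a, f p]`), outside it lies below the level
  `a` of the feet (monotonicity of `g` and `f` along the two halves of the arc,
  `LeftHandDiscArcLevels.lean`, and `FeetOnLeftHandDisc.lean`);
* `Compat.mk_arcLoop_eq` — **`[α₋ · C_q · α₊⁻¹] = [A₋ · K · A₊⁻¹]`** with `A±`, `K` as above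
  (the outer pieces of the arc are pushed down to the seed level along the unit-speed flow of
  the handle side, `FlowTrack.mk_eq_orbit_trans_pushDown`; the push-down of a point of the arc
  below the feet stays below the seed level or on its own level).

Also two pieces of bookkeeping: `trans_trans_homotopic_of_extend` (a path is homotopic to
the concatenation of three consecutive reparametrised pieces) and a groupoid identity.

## References

* F. Laudenbach, V. Poénaru, *A note on 4-dimensional handlebodies*, Bull. Soc. Math. France
  100 (1972), p. 339 (the basis) and proof of Lemma 2 (p. 340). [LaudenbachPoenaruBSMF1972]
* J. Milnor, *Lectures on the h-cobordism theorem* (1965), Def. 3.9, proofs of Thm. 3.4 and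
  Thm. 3.13. [MilnorHCobordism1965]
* A. Hatcher, *Algebraic Topology* (2002), Lemma 1.19. [HatcherAT2002]
-/

open scoped Manifold ContDiff Topology unitInterval
open Set Function Filter Metric Module
open Literature.AlgebraicTopology.FundamentalGroup

noncomputable section

namespace Literature.Topology.FourManifolds

universe u

/-! ### Path bookkeeping -/

namespace SlideBasisLoop

variable {X : Type*} [TopologicalSpace X]

/-- **A path is homotopic to the concatenation of three consecutive pieces**: if
`P₁ s = γ(t₁ s)`, `P₂ s = γ(t₁ + (t₂ - t₁) s)`, `P₃ s = γ(t₂ + (1 - t₂) s)` (`0 ≤ t₁ ≤ t₂ ≤ 1`,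
values read through `γ.extend`), then `(P₁ · P₂) · P₃ ≃ γ` rel end points (the
reparametrisation principle, `PathSegment.homotopic_of_extend`). [folklore] -/
theorem trans_trans_homotopic_of_extend {x y u v : X} (γ : Path x y) {t₁ t₂ : ℝ}
    (P₁ : Path x u) (P₂ : Path u v) (P₃ : Path v y)
    (h₁ : ∀ s : I, P₁ s = γ.extend (t₁ * s)) (h₂ : ∀ s : I, P₂ s = γ.extend (t₁ + (t₂ - t₁) * s))
    (h₃ : ∀ s : I, P₃ s = γ.extend (t₂ + (1 - t₂) * s)) :
    ((P₁.trans P₂).trans P₃).Homotopic γ := by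
  -- the piecewise affine parameter of the concatenation
  set p : I → ℝ := fun s =>
    if (s : ℝ) ≤ 1 / 4 then t₁ * (4 * s) else if (s : ℝ) ≤ 1 / 2 then t₁ + (t₂ - t₁) * (4 * s - 1)
      else t₂ + (1 - t₂) * (2 * s - 1) with hp
  have hpc : Continuous p := by
    refine Continuous.if_le ?_ ?_ continuous_subtype_val continuous_const (fun s hs => ?_)
    · fun_prop
    · refine Continuous.if_le ?_ ?_ continuous_subtype_val continuous_const (fun s hs => ?_)
      · fun_prop
      · fun_prop
      · rw [hs]; ring
    · rw [hs, if_pos (by norm_num : (1 / 4 : ℝ) ≤ 1 / 2)]; ring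
  refine PathSegment.homotopic_of_extend γ _ _ p (fun s => (s : ℝ)) hpc continuous_subtype_val (fun s => ?_)
    (fun s => (γ.extend_extends' s).symm) (by simp [hp]) (by norm_num [hp])
  -- pointwise: unfold the two concatenations
  rw [Path.trans_apply]
  by_cases hs2 : (s : ℝ) ≤ 1 / 2
  · rw [dif_pos hs2, Path.trans_apply]
    by_cases hs4 : (2 * (s : ℝ)) ≤ 1 / 2
    · have hs4' : (s : ℝ) ≤ 1 / 4 := by linarith
      rw [dif_pos (by exact_mod_cast hs4), h₁, hp]
      simp only [if_pos hs4']
      congr 1; ring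
    · have hs4' : ¬ (s : ℝ) ≤ 1 / 4 := fun h => hs4 (by linarith)
      rw [dif_neg (by exact_mod_cast hs4), h₂, hp]
      simp only [if_neg hs4', if_pos hs2]
      congr 1; ring
  · rw [dif_neg hs2, h₃, hp]
    have hs4' : ¬ (s : ℝ) ≤ 1 / 4 := fun h => hs2 (by linarith)
    simp only [if_neg hs4', if_neg hs2]

/-- Groupoid bookkeeping: from `[γ] = [P₁]·[P₂]·[P₃]`, `[P₁⁻¹] = [O₁]·[D₁]`, `[P₃] = [O₃]·[D₃]`
deduce `[α₋ · γ · α₊⁻¹] = [(α₋ · D₁⁻¹) · (O₁⁻¹ · P₂ · O₃) · (α₊ · D₃⁻¹)⁻¹]`. [folklore] -/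
theorem mk_arcLoop_eq_of {x₀ x y u v w₁ w₃ : X} (αm : Path x₀ x) (αp : Path x₀ y) (γ : Path x y)
    (P₁ : Path x u) (P₂ : Path u v) (P₃ : Path v y) (O₁ : Path u w₁) (D₁ : Path w₁ x) (O₃ : Path v w₃) (D₃ : Path w₃ y)
    (hγ : Path.Homotopic.Quotient.mk γ =
      ((Path.Homotopic.Quotient.mk P₁).trans (Path.Homotopic.Quotient.mk P₂)).trans (Path.Homotopic.Quotient.mk P₃))
    (h₁ : Path.Homotopic.Quotient.mk P₁.symm = (Path.Homotopic.Quotient.mk O₁).trans (Path.Homotopic.Quotient.mk D₁))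
    (h₃ : Path.Homotopic.Quotient.mk P₃ = (Path.Homotopic.Quotient.mk O₃).trans (Path.Homotopic.Quotient.mk D₃)) :
    Path.Homotopic.Quotient.mk ((αm.trans γ).trans αp.symm) =
      Path.Homotopic.Quotient.mk (((αm.trans D₁.symm).trans ((O₁.symm.trans P₂).trans O₃)).trans (αp.trans D₃.symm).symm) := by
  have h₁' : Path.Homotopic.Quotient.mk P₁ = (Path.Homotopic.Quotient.mk D₁).symm.trans (Path.Homotopic.Quotient.mk O₁).symm := by
    rw [← IsotopyTrack.quotient_symm_symm (Path.Homotopic.Quotient.mk P₁), ← Path.Homotopic.Quotient.mk_symm, h₁,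
      IsotopyTrack.quotient_symm_trans]
  simp only [Path.Homotopic.Quotient.mk_trans, Path.Homotopic.Quotient.mk_symm, hγ, h₁', h₃,
    IsotopyTrack.quotient_symm_trans, IsotopyTrack.quotient_symm_symm, Path.Homotopic.Quotient.trans_assoc]

end SlideBasisLoop

/-! ### The feet on the arc -/

variable {n : ℕ} {M₀ N₀ : Type u} [TopologicalSpace M₀] [ChartedSpace (EuclideanSpace ℝ (Fin n)) M₀]
  [TopologicalSpace N₀] [ChartedSpace (EuclideanSpace ℝ (Fin n)) N₀]

namespace Cobordism.LeftSphereSetting.Compat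

variable {c : Cobordism n M₀ N₀} {g : c.W → ℝ} {ξ : Π x : c.W, TangentSpace (𝓡∂ (n + 1)) x}
  {L : LeftSphereSetting c g ξ 0} {C : SlideContext n c.W} (h : Compat L C)
  {e₀ e₁ : c.W} (Cq : Path e₀ e₁) (hinj : Injective Cq) (hrange : range Cq = leftHandDisc (𝓡∂ (n + 1)) g ξ L.q L.b)
  (hnn : ∀ z, 0 ≤ mlineDeriv (𝓡∂ (n + 1)) C.S.f z (ξ z))
  (hpos : ∀ z, ¬ IsMCriticalPt (𝓡∂ (n + 1)) g z → 0 < mlineDeriv (𝓡∂ (n + 1)) C.S.f z (ξ z))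

/-- `C.S.f` of the feet is the cut level `a`. [cite: MilnorHCobordism1965, Def. 3.1] -/
theorem apply_f_foot (C : SlideContext n c.W) {s : ℝ} (hs : s ^ 2 = 1) : C.S.f (C.S.D.foot s C.toCtx.m C.toCtx.ρ 0) = C.S.a := by
  have h1 : C.S.f (C.S.D.foot s C.toCtx.m C.toCtx.ρ 0) = C.S.f C.S.p - C.toCtx.m := C.toCtx.T.apply_foot C.toCtx.ρ_pos C.toCtx.hmR hs 0
  have h2 : C.S.f C.S.p - C.toCtx.m = C.S.a := by have := C.toCtx.fp_sub_m; simpa only [SlideContext.toCtx_S] using this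
  rw [h1, h2]

include h hinj hrange hnn hpos in
/-- **The feet on the arc.**  There are the critical parameter `s_q` (`C_q s_q = q`), parameters
`t₋ < s_q < t₊` and a sign `sg = ±1` with `C_q t₋`, `C_q t₊` the centres of the feet of signs
`sg`, `-sg`; on `[t₋, t₊]` the arc runs in the handle region with `C.S.f ∈ [a, f p]`, and outside
it `C.S.f ≤ a`. [cite: MilnorHCobordism1965, Def. 3.9 (PDF p. 16), proof of Thm. 3.13 (PDF p. 18)] -/
theorem exists_feet_params :
    ∃ (s_q tm tp : I) (sg : ℝ), (sg = 1 ∨ sg = -1) ∧ Cq s_q = L.q ∧ tm < s_q ∧ s_q < tp ∧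
      Cq tm = C.S.D.foot sg C.toCtx.m C.toCtx.ρ 0 ∧ Cq tp = C.S.D.foot (-sg) C.toCtx.m C.toCtx.ρ 0 ∧
      (∀ s : I, tm ≤ s → s ≤ tp → Cq s ∈ C.S.N ∧ C.S.a ≤ C.S.f (Cq s) ∧ C.S.f (Cq s) ≤ C.S.f C.S.p) ∧
      (∀ s : I, s ≤ tm ∨ tp ≤ s → C.S.f (Cq s) ≤ C.S.a) ∧
      (∀ s : I, tm ≤ s → s ≤ tp → ∃ v : EuclideanSpace ℝ (Fin 1), ‖v‖ ≤ √C.toCtx.m / L.ε ∧ L.discPoint v = Cq s) := by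
  obtain ⟨s_q, hs_q, -⟩ := L.existsUnique_apply_eq_q Cq hinj hrange
  have hm : 0 < C.toCtx.m := C.toCtx.T.hm
  -- the parameters of the two feet
  have hfoot : ∀ (sg : ℝ) (hsg : sg ^ 2 = 1), ∃ t : I, Cq t = C.S.D.foot sg C.toCtx.m C.toCtx.ρ 0 := fun sg hsg => by
    have : C.S.D.foot sg C.toCtx.m C.toCtx.ρ 0 ∈ range Cq := by rw [hrange]; exact h.foot_mem_leftHandDisc hsg
    obtain ⟨t, ht⟩ := this; exact ⟨t, ht⟩
  obtain ⟨t₁, ht₁⟩ := hfoot 1 (one_pow 2)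
  obtain ⟨t₂, ht₂⟩ := hfoot (-1) neg_one_sq
  have hg₁ : g (Cq t₁) = g L.q - C.toCtx.m := by rw [ht₁]; exact h.apply_g_foot (one_pow 2)
  have hg₂ : g (Cq t₂) = g L.q - C.toCtx.m := by rw [ht₂]; exact h.apply_g_foot neg_one_sq
  have ht₁q : t₁ ≠ s_q := fun heq => by rw [heq, hs_q] at hg₁; linarith
  have ht₂q : t₂ ≠ s_q := fun heq => by rw [heq, hs_q] at hg₂; linarith
  have ht₁₂ : t₁ ≠ t₂ := fun heq => foot_one_ne_foot_neg_one (C := C) (by rw [← ht₁, ← ht₂, heq])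
  obtain ⟨hmono, hanti⟩ := L.strictMonoOn_and_strictAntiOn_apply_arc Cq hinj hrange hs_q
  -- the two feet lie on opposite sides of `s_q`
  have hsides : (t₁ < s_q ∧ s_q < t₂) ∨ (t₂ < s_q ∧ s_q < t₁) := by
    rcases lt_or_gt_of_ne ht₁q with h1 | h1 <;> rcases lt_or_gt_of_ne ht₂q with h2 | h2
    · exfalso; exact ht₁₂ (hmono.injOn (show t₁ ∈ {s | s ≤ s_q} from h1.le) (show t₂ ∈ {s | s ≤ s_q} from h2.le) (hg₁.trans hg₂.symm))
    · exact Or.inl ⟨h1, h2⟩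
    · exact Or.inr ⟨h2, h1⟩
    · exfalso; exact ht₁₂ (hanti.injOn (show t₁ ∈ {s | s_q ≤ s} from h1.le) (show t₂ ∈ {s | s_q ≤ s} from h2.le) (hg₁.trans hg₂.symm))
  -- name the lower and the upper one
  obtain ⟨tm, tp, sg, hsg1, htm, htp, hCtm, hCtp⟩ : ∃ (tm tp : I) (sg : ℝ), (sg = 1 ∨ sg = -1) ∧ tm < s_q ∧ s_q < tp ∧
      Cq tm = C.S.D.foot sg C.toCtx.m C.toCtx.ρ 0 ∧ Cq tp = C.S.D.foot (-sg) C.toCtx.m C.toCtx.ρ 0 := by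
    rcases hsides with ⟨h1, h2⟩ | ⟨h2, h1⟩
    · exact ⟨t₁, t₂, 1, Or.inl rfl, h1, h2, ht₁, by rw [ht₂]⟩
    · exact ⟨t₂, t₁, -1, Or.inr rfl, h2, h1, ht₂, by rw [ht₁, neg_neg]⟩
  have hsg : sg ^ 2 = 1 := by rcases hsg1 with rfl | rfl <;> norm_num
  have hsg' : (-sg) ^ 2 = 1 := by rw [neg_sq, hsg]
  have hgm : g (Cq tm) = g L.q - C.toCtx.m := by rw [hCtm]; exact h.apply_g_foot hsg
  have hgp : g (Cq tp) = g L.q - C.toCtx.m := by rw [hCtp]; exact h.apply_g_foot hsg'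
  -- the middle: `g ≥ g q - m`, hence an axis point of the handle region
  have hmidv : ∀ s : I, tm ≤ s → s ≤ tp → ∃ v : EuclideanSpace ℝ (Fin 1), ‖v‖ ≤ √C.toCtx.m / L.ε ∧ L.discPoint v = Cq s := by
    intro s hs1 hs2
    have hgs : g L.q - C.toCtx.m ≤ g (Cq s) := by
      rcases le_total s s_q with hsq | hsq
      · rw [← hgm]; exact hmono.monotoneOn (show tm ∈ {s | s ≤ s_q} from htm.le) (show s ∈ {s | s ≤ s_q} from hsq) hs1
      · rw [← hgp]; exact hanti.antitoneOn (show s ∈ {s | s_q ≤ s} from hsq) (show tp ∈ {s | s_q ≤ s} from htp.le) hs2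
    have hsLD : Cq s ∈ leftHandDisc (𝓡∂ (n + 1)) g ξ L.q L.b := by rw [← hrange]; exact mem_range_self s
    exact h.exists_discPoint_eq_of_le hsLD hgs
  refine ⟨s_q, tm, tp, sg, hsg1, hs_q, htm, htp, hCtm, hCtp, fun s hs1 hs2 => ?_, fun s hs => ?_, hmidv⟩
  · obtain ⟨v, hv, hvs⟩ := hmidv s hs1 hs2
    rw [← hvs]
    exact h.discPoint_mem_N hv
  · -- the outside: below the level `a` of the feet
    obtain ⟨hnn', hpos'⟩ := L.slabField_hyps hnn hpos
    exact (L.apply_arc_le_iff Cq hinj hrange C.S.hf hnn' hpos' hs_q htm.le htp.le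
      (by rw [hCtm]; exact apply_f_foot C hsg) (by rw [hCtp]; exact apply_f_foot C hsg') s).2 hs

/-! ### Pushing the outer pieces of the arc down to the seed level -/

/-- The flow end point of the foot of sign `sg`, `θ (-(a - c), foot)`, is the centre of the
flowed-down disc of sign `sg` read in `M`. [folklore] -/
theorem theta_neg_foot (C : SlideContext n c.W) {sg : ℝ} (hsg : sg ^ 2 = 1) :
    C.S.θ (-(C.S.a - C.c), C.S.D.foot sg C.toCtx.m C.toCtx.ρ 0) = C.toCtx.Sl'.levelIncl (C.toCtx.disc' hsg 0) := by
  have h2 : C.S.f C.S.p - C.toCtx.m = C.S.a := by have := C.toCtx.fp_sub_m; simpa only [SlideContext.toCtx_S] using this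
  show C.S.θ (-(C.S.a - C.c), C.S.D.foot sg C.toCtx.m C.toCtx.ρ 0) =
    C.S.θ (C.c + 0 - (C.S.f C.S.p - C.toCtx.m'), C.S.D.foot sg C.toCtx.m' C.toCtx.ρ 0)
  rw [SlideContext.toCtx_m', h2, show C.c + 0 - C.S.a = -(C.S.a - C.c) by ring]

/-- The clock of the unit-speed slab of the slide context. [cite: MilnorHCobordism1965, proof of Thm. 3.4 (PDF p. 13)] -/
theorem clock (C : SlideContext n c.W) : ∀ x t, C.S.f x ∈ Ioo C.S.ℓ₁ (C.S.a + 2 * C.S.η) → C.S.f x + t ∈ Ioo C.S.ℓ₁ (C.S.a + 2 * C.S.η) →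
    C.S.f (C.S.θ (t, x)) = C.S.f x + t := fun x t hx ht => C.toCtx.Sl.apply_flow (x := x) hx (t := t) ht

/-- **Pushing a descending piece of the arc down to the seed level.**  For a path `D` from the
centre of the foot of sign `sg` to a point `e` below the seed level `c`, along which
`C.S.f ≤ a`: `[D] = [O] · [D']` with `O` the backward orbit segment of the foot down to the level
`c` and `D'` the push-down of `D`, a path inside `{f ≤ c}`. [cite: HatcherAT2002, Lemma 1.19]
[cite: MilnorHCobordism1965, proof of Thm. 3.4 (PDF p. 13)] -/
theorem exists_pushDown_path (C : SlideContext n c.W) {sg : ℝ} (hsg : sg ^ 2 = 1) {e : c.W}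
    (D : Path (C.S.D.foot sg C.toCtx.m C.toCtx.ρ 0) e) (he : C.S.f e ≤ C.c) (hD : ∀ s, C.S.f (D s) ≤ C.S.a) :
    ∃ (O : Path (C.S.D.foot sg C.toCtx.m C.toCtx.ρ 0) (C.S.θ (-(C.S.a - C.c), C.S.D.foot sg C.toCtx.m C.toCtx.ρ 0)))
      (D' : Path (C.S.θ (-(C.S.a - C.c), C.S.D.foot sg C.toCtx.m C.toCtx.ρ 0)) e),
      (∀ s : I, ∃ t : ℝ, 0 ≤ t ∧ t ≤ C.S.a - C.c ∧ O s = C.S.θ (t, C.S.θ (-(C.S.a - C.c), C.S.D.foot sg C.toCtx.m C.toCtx.ρ 0))) ∧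
      (∀ s, C.S.f (D' s) ≤ C.c) ∧
      Path.Homotopic.Quotient.mk D = (Path.Homotopic.Quotient.mk O).trans (Path.Homotopic.Quotient.mk D') := by
  have hθ : Continuous C.S.θ := C.S.flow.contMDiff.continuous
  have h0 : ∀ x, C.S.θ (0, x) = x := C.S.isFlowOf.map_zero
  set f : C(c.W, ℝ) := ⟨C.S.f, C.S.hf.continuous⟩ with hf
  have hτ := C.τ_pos; have hη := C.S.η_pos
  have hc_le : C.c + 8 * C.τ ≤ C.S.a - 24 * C.S.ε ^ 2 := by
    have := C.toCtx.c_le; simpa only [SlideContext.toCtx_c, SlideContext.toCtx_τ, SlideContext.toCtx_S] using this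
  have hac : C.c ≤ C.S.a := by linarith [sq_nonneg C.S.ε]
  have hfF : C.S.f (C.S.D.foot sg C.toCtx.m C.toCtx.ρ 0) = C.S.a := apply_f_foot C hsg
  have hT : FlowTrack.dropTime f C.c (C.S.D.foot sg C.toCtx.m C.toCtx.ρ 0) = C.S.a - C.c := by
    rw [FlowTrack.dropTime_eq_of_le f C.c (by show C.c ≤ C.S.f (C.S.D.foot sg C.toCtx.m C.toCtx.ρ 0); rw [hfF]; exact hac)]
    show C.S.f (C.S.D.foot sg C.toCtx.m C.toCtx.ρ 0) - C.c = _; rw [hfF]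
  -- the orbit segment
  set O := FlowTrack.orbitPath hθ h0 (-(C.S.a - C.c)) (C.S.D.foot sg C.toCtx.m C.toCtx.ρ 0) with hO
  -- the pushed-down path
  have hP1F : FlowTrack.pushDown hθ f C.c 1 (C.S.D.foot sg C.toCtx.m C.toCtx.ρ 0) = C.S.θ (-(C.S.a - C.c), (C.S.D.foot sg C.toCtx.m C.toCtx.ρ 0)) := by
    rw [FlowTrack.pushDown_apply, one_mul, hT]
  have hP1e : FlowTrack.pushDown hθ f C.c 1 e = e := FlowTrack.pushDown_apply_of_le hθ h0 f C.c 1 he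
  set D' : Path (C.S.θ (-(C.S.a - C.c), (C.S.D.foot sg C.toCtx.m C.toCtx.ρ 0))) e := (D.map (map_continuous (FlowTrack.pushDown hθ f C.c 1))).cast hP1F.symm hP1e.symm with hD'
  refine ⟨O, D', fun s => ?_, fun s => ?_, ?_⟩
  · -- points of the orbit segment
    refine ⟨(1 - (s : ℝ)) * (C.S.a - C.c), by nlinarith [unitInterval.le_one s, unitInterval.nonneg s],
      by nlinarith [unitInterval.le_one s, unitInterval.nonneg s], ?_⟩
    show C.S.θ ((s : ℝ) * (-(C.S.a - C.c)), C.S.D.foot sg C.toCtx.m C.toCtx.ρ 0) = _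
    rw [C.S.isFlowOf.map_add]; exact congrArg (fun r : ℝ => C.S.θ (r, C.S.D.foot sg C.toCtx.m C.toCtx.ρ 0)) (by ring)
  · -- the pushed-down path lies in `{f ≤ c}`
    show C.S.f (FlowTrack.pushDown hθ f C.c 1 (D s)) ≤ C.c
    have hlo : C.S.ℓ₁ < C.c := by rw [C.hℓ₁_eq]; linarith
    exact FlowTrack.apply_pushDown_one_le hθ h0 (f := f) (clock C) hlo (by show C.S.f (D s) < C.S.a + 2 * C.S.η; linarith [hD s])
  · refine FlowTrack.mk_eq_orbit_trans_pushDown hθ h0 f C.c D he O (fun s => ?_) D' (fun s => ?_)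
    · show C.S.θ ((s : ℝ) * (-(C.S.a - C.c)), (C.S.D.foot sg C.toCtx.m C.toCtx.ρ 0)) = C.S.θ (-((s : ℝ) * FlowTrack.dropTime f C.c (C.S.D.foot sg C.toCtx.m C.toCtx.ρ 0)), (C.S.D.foot sg C.toCtx.m C.toCtx.ρ 0))
      rw [hT]; exact congrArg (fun r : ℝ => C.S.θ (r, C.S.D.foot sg C.toCtx.m C.toCtx.ρ 0)) (by ring)
    · show FlowTrack.pushDown hθ f C.c 1 (D s) = _
      rw [FlowTrack.pushDown_apply, one_mul]

include h hinj hrange hnn hpos in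
/-- **The basis loop, rewritten for the slide.**  For paths `α₋ : x₀ ⟶ e₀`, `α₊ : x₀ ⟶ e₁` to
the two end points of the arc (both below the seed level),
`[α₋ · C_q · α₊⁻¹] = [A₋ · K · A₊⁻¹]`, where `A₋ = α₋ · D₁⁻¹`, `A₊ = α₊ · D₃⁻¹` end at the
centres `w∓ = θ (-(a - c), foot)` of the two flowed-down discs, the extra pieces `D₁`, `D₃`
lying in `{f ≤ c}`, and `K = O₁⁻¹ · P₂ · O₃` with `O₁`, `O₃` running on the flow lines
`θ (t, w±)`, `0 ≤ t ≤ a - c`, of the disc centres and `P₂` on the axis of the handle region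
between the feet (`P₂ s = discPoint v`, `‖v‖ ≤ √m/ε_L`, `f ∈ [a, f p]`). [cite: LaudenbachPoenaruBSMF1972, p. 339 and proof of Lemma 2 (p. 340)] [cite: HatcherAT2002, Lemma 1.19] -/
theorem mk_arcLoop_eq (he₀ : C.S.f e₀ ≤ C.c) (he₁ : C.S.f e₁ ≤ C.c) {x₀ : c.W} (αm : Path x₀ e₀) (αp : Path x₀ e₁) :
    ∃ (sg : ℝ)
      (D₁ : Path (C.S.θ (-(C.S.a - C.c), C.S.D.foot sg C.toCtx.m C.toCtx.ρ 0)) e₀)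
      (D₃ : Path (C.S.θ (-(C.S.a - C.c), C.S.D.foot (-sg) C.toCtx.m C.toCtx.ρ 0)) e₁)
      (O₁ : Path (C.S.D.foot sg C.toCtx.m C.toCtx.ρ 0) (C.S.θ (-(C.S.a - C.c), C.S.D.foot sg C.toCtx.m C.toCtx.ρ 0)))
      (P₂ : Path (C.S.D.foot sg C.toCtx.m C.toCtx.ρ 0) (C.S.D.foot (-sg) C.toCtx.m C.toCtx.ρ 0))
      (O₃ : Path (C.S.D.foot (-sg) C.toCtx.m C.toCtx.ρ 0) (C.S.θ (-(C.S.a - C.c), C.S.D.foot (-sg) C.toCtx.m C.toCtx.ρ 0))),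
      (sg = 1 ∨ sg = -1) ∧ (∀ s, C.S.f (D₁ s) ≤ C.c) ∧ (∀ s, C.S.f (D₃ s) ≤ C.c) ∧
      (∀ s : I, ∃ t : ℝ, 0 ≤ t ∧ t ≤ C.S.a - C.c ∧ O₁ s = C.S.θ (t, C.S.θ (-(C.S.a - C.c), C.S.D.foot sg C.toCtx.m C.toCtx.ρ 0))) ∧
      (∀ s : I, ∃ t : ℝ, 0 ≤ t ∧ t ≤ C.S.a - C.c ∧ O₃ s = C.S.θ (t, C.S.θ (-(C.S.a - C.c), C.S.D.foot (-sg) C.toCtx.m C.toCtx.ρ 0))) ∧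
      (∀ s : I, P₂ s ∈ C.S.N ∧ C.S.a ≤ C.S.f (P₂ s) ∧ C.S.f (P₂ s) ≤ C.S.f C.S.p) ∧
      (∀ s : I, ∃ v : EuclideanSpace ℝ (Fin 1), ‖v‖ ≤ √C.toCtx.m / L.ε ∧ L.discPoint v = P₂ s) ∧
      Path.Homotopic.Quotient.mk ((αm.trans Cq).trans αp.symm) =
        Path.Homotopic.Quotient.mk (((αm.trans D₁.symm).trans ((O₁.symm.trans P₂).trans O₃)).trans (αp.trans D₃.symm).symm) := by
  obtain ⟨s_q, tm, tp, sg, hsg1, hs_q, htm, htp, hCtm, hCtp, hmid, hout, hmidv⟩ := h.exists_feet_params Cq hinj hrange hnn hpos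
  have hsg : sg ^ 2 = 1 := by rcases hsg1 with rfl | rfl <;> norm_num
  have hsg' : (-sg) ^ 2 = 1 := by rw [neg_sq, hsg]
  -- the three pieces of the arc
  have hext : ∀ {u : ℝ} (hu : u ∈ Icc (0 : ℝ) 1), Cq.extend u = Cq ⟨u, hu⟩ := fun hu => Cq.extend_extends' ⟨_, hu⟩
  set P₁ : Path e₀ (Cq tm) := (PathSegment.segment Cq 0 tm).cast Cq.extend_zero.symm (Cq.extend_extends' tm).symm with hP₁
  set P₂ : Path (Cq tm) (Cq tp) := (PathSegment.segment Cq tm tp).cast (Cq.extend_extends' tm).symm (Cq.extend_extends' tp).symm with hP₂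
  set P₃ : Path (Cq tp) e₁ := (PathSegment.segment Cq tp 1).cast (Cq.extend_extends' tp).symm Cq.extend_one.symm with hP₃
  have hγ : ((P₁.trans P₂).trans P₃).Homotopic Cq :=
    SlideBasisLoop.trans_trans_homotopic_of_extend Cq P₁ P₂ P₃
      (fun s => by show Cq.extend (0 + ((tm : ℝ) - 0) * s) = _; congr 1; ring)
      (fun s => rfl) (fun s => rfl)
  -- values of the pieces: parameters in `[0, tm]`, `[tm, tp]`, `[tp, 1]`
  have hP₁v : ∀ s : I, ∃ u : I, u ≤ tm ∧ P₁ s = Cq u := fun s => by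
    have hu : (tm : ℝ) * s ∈ Icc (0 : ℝ) 1 :=
      ⟨mul_nonneg (unitInterval.nonneg tm) (unitInterval.nonneg s),
        (mul_le_of_le_one_right (unitInterval.nonneg tm) (unitInterval.le_one s)).trans (unitInterval.le_one tm)⟩
    refine ⟨⟨_, hu⟩, ?_, ?_⟩
    · exact Subtype.coe_le_coe.1 (mul_le_of_le_one_right (unitInterval.nonneg tm) (unitInterval.le_one s))
    · show Cq.extend (0 + ((tm : ℝ) - 0) * s) = _; rw [← hext hu]; congr 1; ring
  have hP₂v : ∀ s : I, ∃ u : I, tm ≤ u ∧ u ≤ tp ∧ P₂ s = Cq u := fun s => by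
    have h1 : (tm : ℝ) ≤ tm + ((tp : ℝ) - tm) * s := by nlinarith [unitInterval.nonneg s, Subtype.coe_le_coe.2 (htm.trans htp).le]
    have h2 : (tm : ℝ) + ((tp : ℝ) - tm) * s ≤ tp := by nlinarith [unitInterval.le_one s, Subtype.coe_le_coe.2 (htm.trans htp).le]
    have hu : (tm : ℝ) + ((tp : ℝ) - tm) * s ∈ Icc (0 : ℝ) 1 := ⟨(unitInterval.nonneg tm).trans h1, h2.trans (unitInterval.le_one tp)⟩
    exact ⟨⟨_, hu⟩, Subtype.coe_le_coe.1 h1, Subtype.coe_le_coe.1 h2, (hext hu)⟩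
  have hP₃v : ∀ s : I, ∃ u : I, tp ≤ u ∧ P₃ s = Cq u := fun s => by
    have h1 : (tp : ℝ) ≤ tp + (1 - (tp : ℝ)) * s := by nlinarith [unitInterval.nonneg s, unitInterval.le_one tp]
    have h2 : (tp : ℝ) + (1 - (tp : ℝ)) * s ≤ 1 := by nlinarith [unitInterval.le_one s, unitInterval.le_one tp, unitInterval.nonneg s]
    have hu : (tp : ℝ) + (1 - (tp : ℝ)) * s ∈ Icc (0 : ℝ) 1 := ⟨(unitInterval.nonneg tp).trans h1, h2⟩
    exact ⟨⟨_, hu⟩, Subtype.coe_le_coe.1 h1, (hext hu)⟩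
  -- push down the two outer pieces
  obtain ⟨O₁, D₁, hO₁, hD₁, h₁⟩ := exists_pushDown_path C hsg (P₁.symm.cast hCtm.symm rfl) he₀ (fun s => by
    show C.S.f (P₁ (unitInterval.symm s)) ≤ C.S.a
    obtain ⟨u, hu, hPu⟩ := hP₁v (unitInterval.symm s); rw [hPu]; exact hout u (Or.inl hu))
  obtain ⟨O₃, D₃, hO₃, hD₃, h₃⟩ := exists_pushDown_path C hsg' (P₃.cast hCtp.symm rfl) he₁ (fun s => by
    show C.S.f (P₃ s) ≤ C.S.a
    obtain ⟨u, hu, hPu⟩ := hP₃v s; rw [hPu]; exact hout u (Or.inr hu))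
  refine ⟨sg, D₁, D₃, O₁, P₂.cast hCtm.symm hCtp.symm, O₃, hsg1, hD₁, hD₃, hO₁, hO₃, fun s => ?_, fun s => ?_, ?_⟩
  · obtain ⟨u, hu1, hu2, hPu⟩ := hP₂v s
    show P₂ s ∈ C.S.N ∧ C.S.a ≤ C.S.f (P₂ s) ∧ C.S.f (P₂ s) ≤ C.S.f C.S.p; rw [hPu]; exact hmid u hu1 hu2
  · obtain ⟨u, hu1, hu2, hPu⟩ := hP₂v s
    show ∃ v : EuclideanSpace ℝ (Fin 1), ‖v‖ ≤ √C.toCtx.m / L.ε ∧ L.discPoint v = P₂ s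
    rw [hPu]; exact hmidv u hu1 hu2
  · -- the identity in the path groupoid
    have e : ((P₁.cast rfl hCtm.symm).trans (P₂.cast hCtm.symm hCtp.symm)).trans (P₃.cast hCtp.symm rfl) =
        (P₁.trans P₂).trans P₃ := by ext s; rfl
    have hγ' : Path.Homotopic.Quotient.mk Cq =
        ((Path.Homotopic.Quotient.mk (P₁.cast rfl hCtm.symm)).trans
          (Path.Homotopic.Quotient.mk (P₂.cast hCtm.symm hCtp.symm))).trans
          (Path.Homotopic.Quotient.mk (P₃.cast hCtp.symm rfl)) := by
      rw [← Path.Homotopic.Quotient.mk_trans, ← Path.Homotopic.Quotient.mk_trans, e]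
      exact Path.Homotopic.Quotient.eq.2 hγ.symm
    exact SlideBasisLoop.mk_arcLoop_eq_of αm αp Cq (P₁.cast rfl hCtm.symm) (P₂.cast hCtm.symm hCtp.symm) (P₃.cast hCtp.symm rfl)
      O₁ D₁ O₃ D₃ hγ' h₁ h₃

end Cobordism.LeftSphereSetting.Compat

end Literature.Topology.FourManifolds
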